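import Summits.QuantumFields.QCD.Theorems.PauliWegnerSeaChiralGluonicCompletionStubSecondMomentOfFmChiralTwo
import Summits.QuantumFields.QCD.Theorems.PauliWegnerSeaChiralGluonicCompletionStubGoldstoneOfSecondMomentTwo
import Summits.QuantumFields.QCD.Theorems.PauliWegnerSeaChiralGluonicCompletionStubFmChiralOfVanishingRateTwo
import Summits.QuantumFields.QCD.Theorems.PauliWegnerSeaChiralGluonicCompletionStubGoldstoneOfSignInputsThree

/-!
# Crux `ChiralGluonicCompletion` (stmt-QuantumFields-17498), line `Sketch` — calibration of the chirality engine against its SOURCE: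
# `MobilityGapPlus` (crux `ChiralMobilityGap`, stmt-QuantumFields-17497) already delivers the EVENTUAL Goldstone bound

The hypothesis `∃ reg, Hyp N_f reg` of `ChiralGluonicCompletion` is supplied, in route WilsonMobilityGap, by `ChiralMobilityGap` (17497) and
`PhaseQuenchedFlavourDecay` (9151) (`hyp_inhabited_of_chiralMobilityGap`, Theorems/…ChiralGluonicCompletionCalibration.lean).  The registered line
of 17497 closes that crux through `ChiralMobilityGapSketch.MobilityGapPlus` (Theorems/WilsonMobilityGapChiralMobilityGapSketchDefs.lean): the clause
package with, at `N_f = 2`, the VANISHING CHIRAL RATE and, at `N_f = 3`, additionally super-logarithmic volumes and sign coherence of the pion-weighted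
determinant — and then WEAKENS this to the typed pin `IsChiralAtZero` (`pinned_of_mobilityGapPlus`).

This file certifies, by composing the four stubs of line `Sketch` landed in cycle 2, that the SAME inputs give the subsequence-stable EVENTUAL Goldstone
lower bound `QCDRegularisation.HasGoldstoneBound` (Literature `QCDGoldstoneBound.lean`) of the witness regularisations themselves:
* `hasGoldstoneBound_of_vanishingChiralRate_two` — `N_f = 2`: `VanishingChiralRate reg → reg.HasGoldstoneBound`
  (`stub_fmChiral_of_vanishingRate_two` ∘ `stub_secondMoment_of_fmChiral_two` ∘ `stub_goldstone_of_secondMoment_two`);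
* `hasGoldstoneBound_of_signInputs_three'` — `N_f = 3`: the clause package (for (iv)), `SuperLogVolume`, `PionWeightSignCoherent` and
  `VanishingChiralRate` give `reg.HasGoldstoneBound` (`stub_goldstone_of_signInputs_three`);
* `goldstone_of_mobilityGapPlus` — hence `MobilityGapPlus` yields, for `N_f = 2` AND `N_f = 3`, a regularisation carrying the clause package AND
  `HasGoldstoneBound` — the strengthening of 17497's `pinned_of_mobilityGapPlus` from the `∃ᶠ`-type pin to the eventual bound.
Consequence for the plan (lead report cycle 2): re-typing the hypothesis of `ChiralGluonicCompletion` from `reg.IsChiralAtZero` to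
`reg.HasGoldstoneBound` costs the upstream constructor NOTHING and closes the chirality engine E of every subsequencing line (`hyp_restrict`,
`HasGoldstoneBound.restrict`), whereas from the typed pin no `∀ reg` transfer back exists (Cruxes/ChiralGluonicCompletion/Disproof.lean §5).
Folklore bookkeeping over landed theorems.
-/

noncomputable section

namespace Summit.QuantumFields.QCD.Theorems.StronglyChiralSubsequence

open MeasureTheory Filter Topology
open Literature.MathematicalPhysics.QuantumFieldTheory Literature.MathematicalPhysics.QuantumLattice
  Literature.Probability.LatticeModels
open Summit.QuantumFields.QCD.Theorems.MobilityGapNegative (Clauses Sign)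
open Summit.QuantumFields.QCD.Theorems.ChiralMobilityGapSketch (VanishingChiralRate SuperLogVolume PionWeightSignCoherent
  MobilityGapPlus)

/-- **`N_f = 2`: the vanishing chiral rate gives the eventual Goldstone bound of the same regularisation** (no subsequence, no sign input:
`det D = (det D_t)² = |det D|` at degenerate tuples) — the composite of the three landed `N_f = 2` stubs of line `Sketch`. [folklore] -/
theorem hasGoldstoneBound_of_vanishingChiralRate_two (reg : QCDRegularisation 2) (hV : VanishingChiralRate reg) :
    reg.HasGoldstoneBound :=
  stub_goldstone_of_secondMoment_two reg
    (stub_secondMoment_of_fmChiral_two reg (stub_fmChiral_of_vanishingRate_two reg hV))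

/-- **`N_f = 3`: the clause package (its clause (iv) at degenerate triples is the `Sign` input), super-logarithmic volumes, sign coherence of
the pion-weighted determinant and the vanishing chiral rate give the eventual Goldstone bound** (landed `stub_goldstone_of_signInputs_three`). [folklore] -/
theorem hasGoldstoneBound_of_signInputs_three' (reg : QCDRegularisation 3) (hC : Clauses 3 reg) (hL : SuperLogVolume reg)
    (hσ : PionWeightSignCoherent reg) (hV : VanishingChiralRate reg) : reg.HasGoldstoneBound :=
  stub_goldstone_of_signInputs_three reg (fun t ht => (hC.2.2 (fun _ => t) fun _ => ht).2.2.2) hL hσ hV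

/-- **`MobilityGapPlus` delivers the EVENTUAL Goldstone bound at both flavour numbers** (strengthening 17497's `pinned_of_mobilityGapPlus`,
which concludes only the `∃ᶠ`-type pin `IsChiralAtZero`): its `N_f = 2` witness and its `N_f = 3` witness each carry the clause package AND
`HasGoldstoneBound` — the hypothesis currency under which the chirality engine of `ChiralGluonicCompletion`'s lines is free. [folklore] -/
theorem goldstone_of_mobilityGapPlus : MobilityGapPlus → (∃ reg : QCDRegularisation 2, Clauses 2 reg ∧ reg.HasGoldstoneBound) ∧ (∃ reg : QCDRegularisation 3, Clauses 3 reg ∧ reg.HasGoldstoneBound) := by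
  rintro ⟨⟨reg₂, hC₂, hV₂⟩, ⟨reg₃, hC₃, hV₃, hL₃, hσ₃⟩⟩
  exact ⟨⟨reg₂, hC₂, hasGoldstoneBound_of_vanishingChiralRate_two reg₂ hV₂⟩,
    ⟨reg₃, hC₃, hasGoldstoneBound_of_signInputs_three' reg₃ hC₃ hL₃ hσ₃ hV₃⟩⟩

/-- … and in particular the pin of both witnesses (`HasGoldstoneBound.isChiralAtZero`), recovering `pinned_of_mobilityGapPlus`'s content
through the eventual bound. [folklore] -/
theorem pinned_of_mobilityGapPlus' (h : MobilityGapPlus) :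
    (∃ reg : QCDRegularisation 2, Clauses 2 reg ∧ reg.IsChiralAtZero) ∧ (∃ reg : QCDRegularisation 3, Clauses 3 reg ∧ reg.IsChiralAtZero) := by
  obtain ⟨⟨reg₂, hC₂, hG₂⟩, ⟨reg₃, hC₃, hG₃⟩⟩ := goldstone_of_mobilityGapPlus h
  exact ⟨⟨reg₂, hC₂, hG₂.isChiralAtZero⟩, ⟨reg₃, hC₃, hG₃.isChiralAtZero⟩⟩

end Summit.QuantumFields.QCD.Theorems.StronglyChiralSubsequence

end
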